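import Mathlib
import HarnessLib
import Summits.FinalStateConjecture.Statement
import Summits.FinalStateConjecture.FinalStateConjecture.Theses.SpectralSurfaceGravity
import Literature.Geometry.Lorentzian.TrappedSurface
import Literature.Geometry.Lorentzian.KerrSurfaceGravity
import Literature.Geometry.Lorentzian.KerrSchild
import Literature.Geometry.Lorentzian.LocFinalStateSettling

/-!
# Birth skeleton (BC3) of the crux piece `CensoredLocSettling` (stmt-FinalStateConjecture-18351) of route
# SpectralSurfaceGravity — crux-strategist 2026-08-17

Two registered stubs and the kernel-checked composition `CensoredLocSettling_of : Theses.SpectralSurfaceGravity.CensoredLocSettling` (registered shape: zero hypotheses, stubs used inside, through the frame lemma `censoredLocSettling_frame`). The cut separates the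
ANALYTIC heart from the CAUSAL-GEOMETRIC normalisation of the charts:

* `stub_locCapture` — every MGHD of admissible data with complete `𝓘⁺` admits SOME chart system `(O, q)` with the two
  convergence clauses (hole charts → boosted Kerr in `C²` on every shell `{r₊ᵢ+δ ≤ rᵢ ≤ R}`; flat chart → `η`) on the
  self-determined exterior `O = J⁺(ιX) ∩ I⁻(q.charted)` with every future-complete null ray from the data in `closure O`
  (capture + asymptotic stability in `C²_loc`, all censored data; the final-state content).
* `stub_locExhaust` — any such `(O, q)` can be re-charted, keeping `O`, into a `C²_loc` settling in the full sense
  (`CauchyDevelopment.IsLocSettling`: honest growing radii with excised growing convergence, causal exhaustion of `O` by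
  the certified slabs for every chart time, future-oriented chart times) — the audit-D2 content: hole charts must reach
  down to the horizons, chart time must agree with causal order.
-/

set_option linter.dupNamespace false

noncomputable section

open scoped BigOperators Topology Manifold Classical MeasureTheory ProbabilityTheory Matrix InnerProductSpace ComplexConjugate ContinuousMap
open Filter Set Function TopologicalSpace MeasureTheory

namespace Summit.FinalStateConjecture.FinalStateConjecture.Cruxes.CensoredLocSettling.Birth

/-- **stub** — capture into `C²_loc` Kerr charts on the self-determined exterior (all censored data). Why plausibly
true: it is the final-state picture (Dafermos–Luk 1710.01722 §1.2.1) read without genericity, sub-extremality or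
horizon uniformity; why it might fail: a non-generic censored development that never settles. Size: open-problem class. -/
theorem stub_locCapture :
    ∀ (X : Type) [TopologicalSpace X] [ChartedSpace Literature.Geometry.Lorentzian.E3 X] [IsManifold (𝓡 3) ((⊤ : ℕ∞) : WithTop ℕ∞) X] [T2Space X] [SecondCountableTopology X] [ConnectedSpace X], ∀ D ∈ Literature.Geometry.Lorentzian.admissibleVacuumData X, ∀ 𝒟 : Literature.Geometry.Lorentzian.VacuumCauchyDevelopment D, 𝒟.IsMaximal → Summit.FinalStateConjecture.HasCompleteNullInfinity 𝒟.toCauchyDevelopment → ∃ (O : Set 𝒟.carrier) (q : Literature.Geometry.Lorentzian.QuasiFinalStateDecomposition 𝒟.toSpacetime O 2 ⊤), (∀ i (δ R : ℝ), 0 < δ → Tendsto (fun τ ↦ 𝒟.toSpacetime.annularDeviationCk (q.background i) (q.chart i) 2 (Literature.Geometry.Lorentzian.Kerr.rPlus (q.mass i) (q.spin i) + δ) R τ) atTop (𝓝 0)) ∧ Tendsto (fun τ ↦ 𝒟.toSpacetime.deviationCk (Literature.Geometry.Lorentzian.Minkowski.backgroundOn q.flatDomain) q.flatChart 2 τ)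 atTop (𝓝 0) ∧ O = Summit.FinalStateConjecture.exteriorOf 𝒟.toCauchyDevelopment q.charted ∧ Summit.FinalStateConjecture.RaysStayInClosure 𝒟.toCauchyDevelopment O := by
  sorry

/-- **stub** — chart normalisation: exhaustive honest radii + future orientation for a captured exterior (all data).
Why plausibly true: `C²_loc` convergence for EVERY `δ > 0` lets the near zones grow (diagonal choice of `Rᵢ(τ) → ∞` and
of inner margins), and on the self-determined exterior with rays in its closure the certified slabs are eventually
honest spacelike pieces whose pasts exhaust `O`; orientation is read off the push-forwards of the Kerr time vectors.
Why it might fail: hole charts of a merely `C²_loc`-convergent system need not reach the event horizon at any fixed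
time, so causal exhaustion for EVERY `τ₁ > τ₀` may need re-charting with information the hypothesis does not carry.
Size: L (Lorentzian causal geometry over the prelude). -/
theorem stub_locExhaust :
    ∀ (X : Type) [TopologicalSpace X] [ChartedSpace Literature.Geometry.Lorentzian.E3 X] [IsManifold (𝓡 3) ((⊤ : ℕ∞) : WithTop ℕ∞) X] [T2Space X] [SecondCountableTopology X] [ConnectedSpace X], ∀ D ∈ Literature.Geometry.Lorentzian.admissibleVacuumData X, ∀ 𝒟 : Literature.Geometry.Lorentzian.VacuumCauchyDevelopment D, 𝒟.IsMaximal → ∀ (O : Set 𝒟.carrier) (q : Literature.Geometry.Lorentzian.QuasiFinalStateDecomposition 𝒟.toSpacetime O 2 ⊤), ((∀ i (δ R : ℝ), 0 < δ → Tendsto (fun τ ↦ 𝒟.toSpacetime.annularDeviationCk (q.background i) (q.chart i) 2 (Literature.Geometry.Lorentzian.Kerr.rPlus (q.mass i) (q.spin i) + δ) R τ) atTop (𝓝 0)) ∧ Tendsto (fun τ ↦ 𝒟.toSpacetime.deviationCk (Literature.Geometry.Lorentzian.Minkowski.backgroundOn q.flatDomain) q.flatChart 2 τ) atTop (𝓝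 0) ∧ O = Summit.FinalStateConjecture.exteriorOf 𝒟.toCauchyDevelopment q.charted ∧ Summit.FinalStateConjecture.RaysStayInClosure 𝒟.toCauchyDevelopment O) → ∃ q' : Literature.Geometry.Lorentzian.QuasiFinalStateDecomposition 𝒟.toSpacetime O 2 ⊤, 𝒟.toCauchyDevelopment.IsLocSettling O q' := by
  sorry

/-- **Composition** — capture, then normalise the charts on the same region. [folklore] -/
theorem censoredLocSettling_frame
    (h₁ : ∀ (X : Type) [TopologicalSpace X] [ChartedSpace Literature.Geometry.Lorentzian.E3 X] [IsManifold (𝓡 3) ((⊤ : ℕ∞) : WithTop ℕ∞) X] [T2Space X] [SecondCountableTopology X] [ConnectedSpace X], ∀ D ∈ Literature.Geometry.Lorentzian.admissibleVacuumData X, ∀ 𝒟 : Literature.Geometry.Lorentzian.VacuumCauchyDevelopment D, 𝒟.IsMaximal → Summit.FinalStateConjecture.HasCompleteNullInfinity 𝒟.toCauchyDevelopment → ∃ (O : Set 𝒟.carrier) (q : Literature.Geometry.Lorentzian.QuasiFinalStateDecomposition 𝒟.toSpacetime O 2 ⊤), (∀ i (δ R : ℝ), 0 < δ → Tendsto (fun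 τ ↦ 𝒟.toSpacetime.annularDeviationCk (q.background i) (q.chart i) 2 (Literature.Geometry.Lorentzian.Kerr.rPlus (q.mass i) (q.spin i) + δ) R τ) atTop (𝓝 0)) ∧ Tendsto (fun τ ↦ 𝒟.toSpacetime.deviationCk (Literature.Geometry.Lorentzian.Minkowski.backgroundOn q.flatDomain) q.flatChart 2 τ) atTop (𝓝 0) ∧ O = Summit.FinalStateConjecture.exteriorOf 𝒟.toCauchyDevelopment q.charted ∧ Summit.FinalStateConjecture.RaysStayInClosure 𝒟.toCauchyDevelopment O)
    (h₂ : ∀ (X : Type) [TopologicalSpace X] [ChartedSpace Literature.Geometry.Lorentzian.E3 X] [IsManifold (𝓡 3) ((⊤ : ℕ∞) : WithTop ℕ∞) X] [T2Space X] [SecondCountableTopology X] [ConnectedSpace X], ∀ D ∈ Literature.Geometry.Lorentzian.admissibleVacuumData X, ∀ 𝒟 : Literature.Geometry.Lorentzian.VacuumCauchyDevelopment D, 𝒟.IsMaximal → ∀ (O : Set 𝒟.carrier) (q : Literature.Geometry.Lorentzian.QuasiFinalStateDecomposition 𝒟.toSpacetime O 2 ⊤), ((∀ i (δ R : ℝ),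 0 < δ → Tendsto (fun τ ↦ 𝒟.toSpacetime.annularDeviationCk (q.background i) (q.chart i) 2 (Literature.Geometry.Lorentzian.Kerr.rPlus (q.mass i) (q.spin i) + δ) R τ) atTop (𝓝 0)) ∧ Tendsto (fun τ ↦ 𝒟.toSpacetime.deviationCk (Literature.Geometry.Lorentzian.Minkowski.backgroundOn q.flatDomain) q.flatChart 2 τ) atTop (𝓝 0) ∧ O = Summit.FinalStateConjecture.exteriorOf 𝒟.toCauchyDevelopment q.charted ∧ Summit.FinalStateConjecture.RaysStayInClosure 𝒟.toCauchyDevelopment O) → ∃ q' : Literature.Geometry.Lorentzian.QuasiFinalStateDecomposition 𝒟.toSpacetime O 2 ⊤, 𝒟.toCauchyDevelopment.IsLocSettling O q') :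
    ∀ (X : Type) [TopologicalSpace X] [ChartedSpace Literature.Geometry.Lorentzian.E3 X] [IsManifold (𝓡 3) ((⊤ : ℕ∞) : WithTop ℕ∞) X] [T2Space X] [SecondCountableTopology X] [ConnectedSpace X], ∀ D ∈ Literature.Geometry.Lorentzian.admissibleVacuumData X, ∀ 𝒟 : Literature.Geometry.Lorentzian.VacuumCauchyDevelopment D, 𝒟.IsMaximal → Summit.FinalStateConjecture.HasCompleteNullInfinity 𝒟.toCauchyDevelopment → ∃ (O : Set 𝒟.carrier) (q : Literature.Geometry.Lorentzian.QuasiFinalStateDecomposition 𝒟.toSpacetime O 2 ⊤), 𝒟.toCauchyDevelopment.IsLocSettling O q := by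
  intro X _ _ _ _ _ _ D hD 𝒟 h𝒟 hscri
  obtain ⟨O, q, hcore⟩ := h₁ X D hD 𝒟 h𝒟 hscri
  obtain ⟨q', h⟩ := h₂ X D hD 𝒟 h𝒟 O q hcore
  exact ⟨O, q', h⟩


/-- **The skeleton concludes the crux BY NAME** (registered shape `<CruxDecl>_of : <CruxDecl>`, the stubs used
inside): the two registered stubs give the route decl `Theses.SpectralSurfaceGravity.CensoredLocSettling` through the frame
composition `censoredLocSettling_frame` (whose conclusion is the decl's body, `δ`-unfolding). -/
theorem CensoredLocSettling_of :
    Summit.FinalStateConjecture.FinalStateConjecture.Theses.SpectralSurfaceGravity.CensoredLocSettling :=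
  censoredLocSettling_frame stub_locCapture stub_locExhaust

end Summit.FinalStateConjecture.FinalStateConjecture.Cruxes.CensoredLocSettling.Birth

end
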